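import Summits.Ventures.YMGap.Census.CharacterTwistGram
import Literature.MathematicalPhysics.QuantumLattice.SU2Haar
import Literature.MathematicalPhysics.QuantumFieldTheory.VortexTwistPlaneSymmetry
import HarnessLib

/-!
# Venture YMGap, track (b) — Tomboulis's Proposition IV.1 `|Z⁻_Λ| ≤ Z_Λ` for EVERY spin cut-off `J`,
# by reflection positivity and the SU(2) character convolution identity

HONEST FRAMING: venture file of the cell `pub-ymgap` (QuantumFields programme), track (b) (exact small-volume
census of Tomboulis's inequalities).  Proved here is a PRINTED, UNDISPUTED finite-volume statement —
E. T. Tomboulis, arXiv:0707.2179, Prop. IV.1 eq. (4.6) `Z⁻_Λ({c_j}) ≤ Z_Λ({c_j})` for `c_j ≥ 0`, with its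
companion `-Z_Λ ≤ Z⁻_Λ` (reflection positivity of `Z⁺ = (Z + Z⁻)/2`, §4.1 eq. (4.7)) — on the even periodic
lattice `(ℤ/Lℤ)^d`, for EVERY spin cut-off `J` of `TomboulisVortexDecimation` (`torusZ`, `torusZtw`, `TwistLe`,
`vortexSheet`, `vortexRatio`), every admissible coefficient sequence and the vortex sheet in every plane.
Nothing here is about the disputed inequality (5.15), the thermodynamic limit, confinement or a mass gap; it
removes the "`|Z⁻| ≤ Z` assumed" clause from census rows at cut-offs `J ≥ 3` (the Literature files
`OneCharacterTwistBound` / `TwoCharacterTwistBound` cover `J = 1, 2` by explicit finite Gram forms).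

Proof (App. A §5: "since `c_j ≥ 0`, all `j`, every term in the sum (A.18) is manifestly non-negative by RP in
`π`", after Osterwalder–Seiler, Ann. Phys. 110 (1978) 440, §2): with the bookkeeping of `CharacterTwistGram`
— sector weights, the split `G(U) G(ΘU) W_×(U)`, the splitting of the crossing links `translate Y`, and every
character kernel `χ_n(g h⁻¹) = (n+1) ∫ χ_n(gR) χ_n(hR) dR` an INTEGRAL Gram form by the character
convolution identity of the venture `LatticeQCDFlow` — the `Q`-sector term is
`T_Q = ∫_Y ∫_U ∫_{R⃗} Σ_x Γ_x Φ_{x,R⃗}(splice_C(U,Y)) Φ_{x,R⃗}(ΘU)`, `Γ_x ≥ 0`; all integrands are continuous on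
compact second-countable spaces, so one application of Fubini puts the auxiliary integral outside, and for
each `R⃗` every term is `|∫ Φ_{x,R⃗}|² ≥ 0` by `LatticeRP.integral_splice_mul_conj_comp_nonneg`.

## Main statements (namespace `Summit.Ventures.YMGap.Census`)

* `tSector_nonneg` — `L` even, `c_j ≥ 0` (`j ≠ 0`), `V` crossing plaquettes, `Q ⊆ V` ⟹ `0 ≤ tSector d L J c V Q`.
* `torusZtw_le_torusZ` (IV.1, eq. (4.6)), `neg_torusZ_le_torusZtw` (eq. (4.7)), `abs_torusZtw_le_torusZ`.
* `twistLe_vortexSheet_plane : TwistLe d L J (vortexSheet L i j hij)` — even `L`, `d ≥ 2`, every `J`, every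
  plane; `abs_torusZtw_vortexSheet_le_torusZ`, `abs_vortexRatio_le_one_plane` (`|Z⁻/Z| ≤ 1`).

References: E. T. Tomboulis, arXiv:0707.2179, Prop. IV.1 eq. (4.6), §4.1 eq. (4.7), App. A §5
[cite: Tomboulis2007Confinement, Prop. IV.1 eq. (4.6); App. A §5]; K. Osterwalder, E. Seiler, Ann. Phys. 110
(1978) 440–471, §2 [cite: OsterwalderSeilerAnnPhys1978, §2].  Scope: even `L` only (no between-slice
reflection on odd tori); twist sets of plaquettes bisected by the reflection hyperplanes (`WilsonRP.IsCrossPlaq`),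
which the sheets `vortexSheet L 0 j` are, the other planes by the axis relabelling of `VortexTwistPlaneSymmetry`.
-/

noncomputable section

open MeasureTheory Finset Real
open scoped BigOperators ComplexConjugate
open Literature.MathematicalPhysics.QuantumLattice
open Literature.MathematicalPhysics.QuantumFieldTheory
open Literature.MathematicalPhysics.QuantumFieldTheory.Tomboulis2007
open Literature.MathematicalPhysics.QuantumFieldTheory.WilsonRP
open Summit.Ventures.LatticeQCDFlow.Exactness

namespace Summit.Ventures.YMGap.Census

variable {d L : ℕ}

section RP

variable [NeZero d] [NeZero L] [Fact (1 < L)]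

/-! #### Continuity (all integrands are continuous functions on compact second-countable spaces) -/

omit [NeZero d] [NeZero L] [Fact (1 < L)] in
/-- `W ↦ Re tr U_p` is continuous. -/
theorem continuous_plaqRe (p : Plaquette d L) :
    Continuous fun W : GaugeConfig d L SU2 => plaqRe rhoFund W p := by
  have h : Continuous fun W : GaugeConfig d L SU2 => plaquetteHolonomy W p.1 p.2.1.1 p.2.1.2 := by
    unfold plaquetteHolonomy
    fun_prop
  have e : (fun W : GaugeConfig d L SU2 => plaqRe rhoFund W p) =
      fun W => 2 * su2a0 (plaquetteHolonomy W p.1 p.2.1.1 p.2.1.2) := by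
    funext W
    simp only [plaqRe, su2a0, fundamentalRep_apply]
    ring
  rw [e]
  exact continuous_const.mul (continuous_su2a0.comp h)

omit [NeZero d] [NeZero L] [Fact (1 < L)] in
/-- `charR n` is continuous. -/
theorem continuous_charR (n : ℕ) : Continuous (charR n) := by
  unfold charR
  exact (Polynomial.continuous _).comp (continuous_id.div_const 2)

omit [NeZero d] [NeZero L] [Fact (1 < L)] in
/-- `fR J c` is continuous. -/
theorem continuous_fR (J : ℕ) (c : ℕ → ℝ) : Continuous (fR J c) := by
  unfold fR
  exact continuous_const.add (continuous_finsetSum _ fun n _ => continuous_const.mul (continuous_charR n))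

omit [NeZero d] [NeZero L] [Fact (1 < L)] in
/-- `sectorWeight … p` is continuous. -/
theorem continuous_sectorWeight (J : ℕ) (c : ℕ → ℝ) (V Q : Finset (Plaquette d L)) (p : Plaquette d L) :
    Continuous (sectorWeight J c V Q p) := by
  unfold sectorWeight
  exact continuous_finsetSum _ fun n _ => continuous_const.mul (continuous_charR n)

omit [Fact (1 < L)] in
/-- `G` is continuous. -/
theorem continuous_gPosJ (J : ℕ) (c : ℕ → ℝ) : Continuous (gPosJ (d := d) (L := L) J c) := by
  unfold gPosJ
  exact continuous_finsetProd _ fun p _ => (continuous_fR J c).comp (continuous_plaqRe p)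

omit [NeZero L] [Fact (1 < L)] in
/-- The features are continuous along continuous maps `z ↦ (F z, G z)` (stated in composed form: the
unifier must never be asked to see through `feat`). -/
theorem continuous_feat_comp (p : Plaquette d L) (n : ℕ) {X : Type*} [TopologicalSpace X]
    {F : X → GaugeConfig d L SU2} {G : X → SU2} (hF : Continuous F) (hG : Continuous G) :
    Continuous fun z : X => feat p n (G z) (F z) := by
  unfold feat
  split_ifs
  · have h1 : Continuous fun W : GaugeConfig d L SU2 => halfPlaq p W := by
      unfold halfPlaq
      split_ifs <;> fun_prop
    have h2 : Continuous fun z : X => halfPlaq p (F z) * G z := (h1.comp hF).mul hG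
    have h3 : Continuous fun z : X => su2a0 (halfPlaq p (F z) * G z) := continuous_su2a0.comp h2
    exact (Polynomial.continuous (Polynomial.Chebyshev.U ℝ (n : ℤ))).comp h3
  · exact continuous_const

omit [NeZero d] [NeZero L] [Fact (1 < L)] in
/-- The coordinate splice is continuous. -/
theorem continuous_splice (C : Finset (Edge d L)) :
    Continuous (LatticeRP.splice C : GaugeConfig d L SU2 × GaugeConfig d L SU2 → GaugeConfig d L SU2) := by
  refine continuous_pi fun e => ?_
  simp only [LatticeRP.splice_apply]
  split_ifs
  · exact (continuous_apply e).comp continuous_snd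
  · exact (continuous_apply e).comp continuous_fst

omit [NeZero L] [Fact (1 < L)] in
/-- The time reflection on configurations is continuous. -/
theorem continuous_timeReflect :
    Continuous (GaugeConfig.timeReflect : GaugeConfig d L SU2 → GaugeConfig d L SU2) := by
  refine continuous_pi fun e => ?_
  simp only [timeReflect_apply]
  split_ifs
  · exact (continuous_apply _).inv
  · exact continuous_apply _

omit [Fact (1 < L)] in
/-- `Φ_{x,R⃗}(W)` is jointly continuous along continuous maps `z ↦ (F z, R⃗(z))`. -/
theorem continuous_PhiX_comp (J : ℕ) (c : ℕ → ℝ) (x : Plaquette d L → ℕ) {X : Type*} [TopologicalSpace X]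
    {F : X → GaugeConfig d L SU2} {Rf : X → Plaquette d L → SU2} (hF : Continuous F) (hR : Continuous Rf) :
    Continuous fun z : X => PhiX J c x (Rf z) (F z) := by
  unfold PhiX
  have hG : Continuous fun z : X => gPosJ J c (F z) := (continuous_gPosJ J c).comp hF
  have hP : Continuous fun z : X => ∏ p, feat p (x p) (Rf z p) (F z) :=
    continuous_finsetProd _ fun p _ => continuous_feat_comp p (x p) hF ((continuous_apply p).comp hR)
  exact hG.mul hP

omit [Fact (1 < L)] in
/-- The tripled integrand is jointly continuous. -/
theorem continuous_Mint (J : ℕ) (c : ℕ → ℝ) (V Q : Finset (Plaquette d L)) :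
    Continuous (Function.uncurry (Mint (d := d) (L := L) J c V Q)) := by
  have h : Function.uncurry (Mint (d := d) (L := L) J c V Q) =
      fun z => ∑ x ∈ Fintype.piFinset (fun _ : Plaquette d L => Finset.range (J + 1)),
        (∏ p, gWt c V Q p (x p)) *
          (PhiX J c x z.2 (LatticeRP.splice crossEdges z.1) * PhiX J c x z.2 (GaugeConfig.timeReflect z.1.1)) := by
    funext z
    rfl
  rw [h]
  refine continuous_finsetSum _ fun x _ => ?_
  have h1 : Continuous fun z : (GaugeConfig d L SU2 × GaugeConfig d L SU2) × (Plaquette d L → SU2) =>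
      PhiX J c x z.2 (LatticeRP.splice crossEdges z.1) :=
    continuous_PhiX_comp J c x ((continuous_splice crossEdges).comp continuous_fst) continuous_snd
  have h2 : Continuous fun z : (GaugeConfig d L SU2 × GaugeConfig d L SU2) × (Plaquette d L → SU2) =>
      PhiX J c x z.2 (GaugeConfig.timeReflect z.1.1) :=
    continuous_PhiX_comp J c x (continuous_timeReflect.comp (continuous_fst.comp continuous_fst))
      continuous_snd
  exact continuous_const.mul (h1.mul h2)

omit [Fact (1 < L)] in
/-- `Φ_{x,R⃗}` is continuous in `W`. -/
theorem continuous_PhiX (J : ℕ) (c : ℕ → ℝ) (x : Plaquette d L → ℕ) (Rv : Plaquette d L → SU2) :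
    Continuous (PhiX J c x Rv) :=
  continuous_PhiX_comp J c x (F := fun W => W) (Rf := fun _ => Rv) continuous_id continuous_const

omit [Fact (1 < L)] in
/-- `z ↦ Φ_{x,R⃗(z)}(F z) Φ_{x,R⃗(z)}(G z)` is continuous along continuous `F`, `G`, `R⃗`. -/
theorem continuous_PhiX_mul (J : ℕ) (c : ℕ → ℝ) (x : Plaquette d L → ℕ) {X : Type*} [TopologicalSpace X]
    {F G : X → GaugeConfig d L SU2} {Rf : X → Plaquette d L → SU2} (hF : Continuous F) (hG : Continuous G)
    (hR : Continuous Rf) : Continuous fun z : X => PhiX J c x (Rf z) (F z) * PhiX J c x (Rf z) (G z) :=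
  (continuous_PhiX_comp J c x hF hR).mul (continuous_PhiX_comp J c x hG hR)

/-- Continuous real functions on the (compact, second countable) configuration spaces are integrable
for the finite product Haar measures (plumbing). -/
theorem integrable_of_continuous_fin {X : Type*} [TopologicalSpace X] [MeasurableSpace X]
    [OpensMeasurableSpace X] [CompactSpace X] {μ : Measure X} [IsFiniteMeasure μ] {F : X → ℝ}
    (hF : Continuous F) : Integrable F μ :=
  hF.integrable_of_hasCompactSupport (HasCompactSupport.of_compactSpace F)

omit [Fact (1 < L)] in
/-- **Change of variables along `translate Y`** (it preserves the product Haar measure,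
`WilsonRP.measurePreserving_translate`): `∫ H(translate Y U) dμ(U) = ∫ H dμ`. -/
theorem integral_comp_translate (Y : GaugeConfig d L SU2) {H : GaugeConfig d L SU2 → ℝ} (hH : Continuous H) :
    ∫ W, H (WilsonRP.translate Y W) ∂(LatticeRP.piMeasure (haarProbability SU2)) =
      ∫ W, H W ∂(LatticeRP.piMeasure (haarProbability SU2)) := by
  haveI : SecondCountableTopology SU2 := secondCountableTopology_su2
  have hT := measurePreserving_translate (d := d) (L := L) (G := SU2) Y
  have h := integral_map (μ := LatticeRP.piMeasure (haarProbability SU2)) (f := H)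
    hT.measurable.aemeasurable hH.aestronglyMeasurable
  rw [hT.map_eq] at h
  exact h.symm

/-! #### The pointwise identity after `translate Y` -/

/-- **The pointwise identity**: after the substitution `translate Y`, the `Q`-sector integrand is the
`R⃗`-integral of the tripled integrand, `∏_p w_p(translate Y U) = ∫ M((U, Y), R⃗) dR⃗`. -/
theorem integrand_translate (hL : Even L) (J : ℕ) (c : ℕ → ℝ) {V Q : Finset (Plaquette d L)}
    (hV : ∀ p ∈ V, IsCrossPlaq p) (hQ : Q ⊆ V) (W Y : GaugeConfig d L SU2) :
    ∏ p : Plaquette d L, sectorWeight J c V Q p (plaqRe rhoFund (translate Y W) p) =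
      ∫ Rv, Mint J c V Q (W, Y) Rv ∂(Measure.pi fun _ : Plaquette d L => haarProbability SU2) := by
  haveI : SecondCountableTopology SU2 := secondCountableTopology_su2
  have hPC : ∀ e : Edge d L, IsPosEdge e → ¬ IsCrossEdge e :=
    fun e he hc => not_isPosEdge_of_isCrossEdge hL hc he
  have hmem : ∀ e : Edge d L, e ∈ ((posEdges : Finset (Edge d L)) : Set (Edge d L)) → IsPosEdge e :=
    fun e he => by simpa using he
  have htr : ∀ e ∈ ((posEdges : Finset (Edge d L)) : Set (Edge d L)), translate Y W e = W e :=
    fun e he => translate_apply_of_not_isCrossEdge Y W (hPC e (hmem e he))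
  have hsp : ∀ e ∈ ((posEdges : Finset (Edge d L)) : Set (Edge d L)),
      LatticeRP.splice crossEdges (W, Y) e = W e :=
    fun e he => splice_apply_of_not_isCrossEdge W Y (hPC e (hmem e he))
  have hΘtr : ∀ e ∈ ((posEdges : Finset (Edge d L)) : Set (Edge d L)),
      (translate Y W).timeReflect e = W.timeReflect e := by
    intro e he
    rw [timeReflect_apply, timeReflect_apply,
      translate_apply_of_not_isCrossEdge Y W (not_isCrossEdge_edgeReflect hL (hmem e he))]
  have hG1 : gPosJ J c (translate Y W) = gPosJ J c (LatticeRP.splice crossEdges (W, Y)) := by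
    rw [gPosJ_congr J c htr, ← gPosJ_congr J c hsp]
  have hG2 : gPosJ J c (translate Y W).timeReflect = gPosJ J c W.timeReflect := gPosJ_congr J c hΘtr
  rw [prod_sectorWeight_split hL J c hV hQ, wCrossJ_translate hL J c V Q W Y, hG1, hG2, Finset.mul_sum]
  unfold Mint
  rw [integral_finsetSum _ (fun x _ =>
    (integrable_of_continuous_fin (continuous_PhiX_mul J c x (F := fun _ => LatticeRP.splice crossEdges (W, Y))
      (G := fun _ => W.timeReflect) (Rf := fun Rv => Rv) continuous_const continuous_const
      continuous_id)).const_mul _)]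
  refine Finset.sum_congr rfl fun x _ => ?_
  rw [← integral_const_mul, ← integral_const_mul]
  refine integral_congr_ae (ae_of_all _ fun Rv => ?_)
  set A := ∏ p, feat p (x p) (Rv p) (LatticeRP.splice crossEdges (W, Y)) with hA
  set B := ∏ p, feat p (x p) (Rv p) W.timeReflect with hB
  simp only [PhiX, ← hA, ← hB]
  ring

/-! #### Reflection positivity for each auxiliary configuration -/

/-- **The RP step for one term**: for a continuous real `Φ` depending only on the links in `P ∪ C`,
`0 ≤ ∫∫ Φ(splice_C(U, Y)) Φ(ΘU) dμ(U) dμ(Y)` (`LatticeRP.integral_splice_mul_conj_comp_nonneg`, the bound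
coming from compactness). -/
theorem rp_term_nonneg (hL : Even L) {Φ : GaugeConfig d L SU2 → ℝ} (hΦc : Continuous Φ)
    (hΦdep : DependsOn Φ ((posEdges ∪ crossEdges : Finset (Edge d L)) : Set (Edge d L))) :
    0 ≤ ∫ q, Φ (LatticeRP.splice crossEdges q) * Φ (GaugeConfig.timeReflect q.1)
      ∂((LatticeRP.piMeasure (haarProbability SU2)).prod
        (LatticeRP.piMeasure (haarProbability SU2))) := by
  haveI : SecondCountableTopology SU2 := secondCountableTopology_su2
  obtain ⟨K, hK⟩ := isCompact_univ.exists_bound_of_continuousOn hΦc.continuousOn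
  have key := LatticeRP.integral_splice_mul_conj_comp_nonneg (haarProbability SU2) posEdges crossEdges
    GaugeConfig.timeReflect measurePreserving_timeReflect
    (fun e he => dependsOn_timeReflect_apply hL e he) (Φ := fun W => ((Φ W : ℝ) : ℂ))
    (Complex.measurable_ofReal.comp hΦc.measurable) (K := K)
    (fun W => by simpa using hK W (Set.mem_univ W)) (fun A B hAB => by simp [hΦdep hAB])
  have h2 : ∫ q, ((Φ (LatticeRP.splice crossEdges q) : ℝ) : ℂ) *
      (starRingEnd ℂ) ((Φ (GaugeConfig.timeReflect q.1) : ℝ) : ℂ)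
      ∂((LatticeRP.piMeasure (haarProbability SU2)).prod
        (LatticeRP.piMeasure (haarProbability SU2))) =
      ((∫ q, Φ (LatticeRP.splice crossEdges q) * Φ (GaugeConfig.timeReflect q.1)
        ∂((LatticeRP.piMeasure (haarProbability SU2)).prod
          (LatticeRP.piMeasure (haarProbability SU2))) : ℝ) : ℂ) := by
    rw [← integral_complex_ofReal]
    refine integral_congr_ae (ae_of_all _ fun q => ?_)
    simp only [Complex.conj_ofReal, Complex.ofReal_mul]
  rw [h2] at key
  exact Complex.zero_le_real.1 key

/-- **Positivity of the inner double integral for every auxiliary configuration `R⃗`**: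
`0 ≤ ∫∫ M((U, Y), R⃗) dμ(U) dμ(Y) = Σ_x Γ_x |∫ Φ_{x,R⃗}|²`. -/
theorem inner_nonneg (hL : Even L) (J : ℕ) {c : ℕ → ℝ} (hc : ∀ n, 1 ≤ n → 0 ≤ c n)
    (V Q : Finset (Plaquette d L)) (Rv : Plaquette d L → SU2) :
    0 ≤ ∫ q, Mint J c V Q q Rv
      ∂((LatticeRP.piMeasure (haarProbability SU2)).prod
        (LatticeRP.piMeasure (haarProbability SU2))) := by
  haveI : SecondCountableTopology SU2 := secondCountableTopology_su2
  unfold Mint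
  rw [integral_finsetSum _ (fun x _ =>
    (integrable_of_continuous_fin (continuous_PhiX_mul J c x (F := LatticeRP.splice crossEdges)
      (G := fun q => GaugeConfig.timeReflect q.1) (Rf := fun _ => Rv) (continuous_splice crossEdges)
      (continuous_timeReflect.comp continuous_fst) continuous_const)).const_mul _)]
  refine Finset.sum_nonneg fun x _ => ?_
  rw [integral_const_mul]
  refine mul_nonneg (Finset.prod_nonneg fun p _ => gWt_nonneg hc V Q p (x p)) ?_
  exact rp_term_nonneg hL (Φ := PhiX J c x Rv) (continuous_PhiX J c x Rv) (dependsOn_PhiX hL J c x Rv)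

/-! ### `T_Q ≥ 0` and Prop. IV.1 for every spin cut-off -/

/-- **Reflection positivity of the twisted sectors, every spin cut-off `J`** (arXiv:0707.2179 App. A §5:
"since `c_j ≥ 0`, all `j`, every term in the sum (A.18) is manifestly non-negative by RP in `π`"): on the
even torus, for `c_j ≥ 0` (`j ≠ 0`), a twist set `V` of plaquettes bisected by the reflection hyperplanes and
every `Q ⊆ V`, `0 ≤ tSector d L J c V Q`.  Proof: Osterwalder–Seiler splitting of the crossing links
(`translate`), every crossing weight an integral Gram form by the character convolution identity,
Fubini over the auxiliary variables, and `LatticeRP.integral_splice_mul_conj_comp_nonneg` termwise. -/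
theorem tSector_nonneg (hL : Even L) (J : ℕ) {c : ℕ → ℝ} (hc : ∀ n, 1 ≤ n → 0 ≤ c n)
    {V Q : Finset (Plaquette d L)} (hV : ∀ p ∈ V, IsCrossPlaq p) (hQ : Q ⊆ V) :
    0 ≤ tSector d L J c V Q := by
  haveI : SecondCountableTopology SU2 := secondCountableTopology_su2
  have hHc : Continuous fun W : GaugeConfig d L SU2 => ∏ p, sectorWeight J c V Q p (plaqRe rhoFund W p) :=
    continuous_finsetProd _ fun p _ => (continuous_sectorWeight J c V Q p).comp (continuous_plaqRe p)
  have hT : tSector d L J c V Q = ∫ W, ∏ p, sectorWeight J c V Q p (plaqRe rhoFund W p)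
      ∂(LatticeRP.piMeasure (haarProbability SU2)) := by
    unfold tSector
    exact integral_congr_ae (ae_of_all _ fun W => tSector_integrand_eq_prod J c hQ W)
  -- Step 1 (splitting the crossing links): `∫ H dμ = ∫∫ H(translate Y U) dμ(U) dμ(Y)`
  have step1 : ∫ W, ∏ p, sectorWeight J c V Q p (plaqRe rhoFund W p) ∂(LatticeRP.piMeasure (haarProbability SU2)) =
      ∫ Y, ∫ W, ∏ p, sectorWeight J c V Q p (plaqRe rhoFund (WilsonRP.translate Y W) p)
        ∂(LatticeRP.piMeasure (haarProbability SU2)) ∂(LatticeRP.piMeasure (haarProbability SU2)) := by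
    simp_rw [integral_comp_translate _ hHc, integral_const, probReal_univ, one_smul]
  -- Step 2 (Gram/convolution expansion): `H(translate Y U) = ∫ M((U,Y), R⃗) dR⃗`
  have step2 : ∀ Y W : GaugeConfig d L SU2,
      ∏ p, sectorWeight J c V Q p (plaqRe rhoFund (WilsonRP.translate Y W) p) =
        ∫ Rv, Mint J c V Q (W, Y) Rv ∂(Measure.pi fun _ : Plaquette d L => haarProbability SU2) :=
    fun Y W => integrand_translate hL J c hV hQ W Y
  -- Step 3 (Fubini on a product of compact probability spaces; the integrand is continuous): collect the
  -- two configuration integrals, exchange with the auxiliary one, and use positivity for each `R⃗`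
  have hMi : Integrable (Function.uncurry (Mint J c V Q))
      (((LatticeRP.piMeasure (haarProbability SU2)).prod (LatticeRP.piMeasure (haarProbability SU2))).prod
        (Measure.pi fun _ : Plaquette d L => haarProbability SU2)) :=
    integrable_of_continuous_fin (continuous_Mint J c V Q)
  rw [hT, step1]
  simp_rw [step2]
  rw [← integral_prod_symm (fun q => ∫ Rv, Mint J c V Q q Rv
      ∂(Measure.pi fun _ : Plaquette d L => haarProbability SU2)) hMi.integral_prod_left,
    integral_integral_swap hMi]
  exact integral_nonneg fun Rv => inner_nonneg hL J hc V Q Rv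

/-- **Tomboulis's Prop. IV.1, eq. (4.6), for every spin cut-off `J`**: on the even torus `(ℤ/Lℤ)^d`, for
`c_j ≥ 0` (`j ≠ 0`) and a twist set `V` of plaquettes bisected by the reflection hyperplanes,
`Z⁻_Λ(V) ≤ Z_Λ` (`Z - Z⁻ = 2 Σ_{|Q| odd} T_Q ≥ 0`). -/
theorem torusZtw_le_torusZ (hL : Even L) (J : ℕ) {c : ℕ → ℝ} (hc : ∀ n, 1 ≤ n → 0 ≤ c n)
    {V : Finset (Plaquette d L)} (hV : ∀ p ∈ V, IsCrossPlaq p) :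
    torusZtw d L J c V ≤ torusZ d L J c :=
  (torusZtw_le_torusZ_iff_sum_nonneg d L J c V).2 (Finset.sum_nonneg fun _ hQ =>
    tSector_nonneg hL J hc hV (Finset.mem_powerset.1 (Finset.mem_filter.1 hQ).1))

/-- **`-Z_Λ ≤ Z⁻_Λ(V)` for every spin cut-off** (the even sectors: `Z + Z⁻ = 2 Σ_{|Q| even} T_Q ≥ 0`, the
reflection positivity of `Z⁺ = (Z + Z⁻)/2`, arXiv:0707.2179 §4.1 eq. (4.7)). -/
theorem neg_torusZ_le_torusZtw (hL : Even L) (J : ℕ) {c : ℕ → ℝ} (hc : ∀ n, 1 ≤ n → 0 ≤ c n)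
    {V : Finset (Plaquette d L)} (hV : ∀ p ∈ V, IsCrossPlaq p) :
    -torusZ d L J c ≤ torusZtw d L J c V := by
  have h := torusZ_add_torusZtw_eq_sum d L J c V
  have h2 : 0 ≤ ∑ Q ∈ V.powerset.filter (fun Q => Even Q.card), tSector d L J c V Q :=
    Finset.sum_nonneg fun Q hQ =>
      tSector_nonneg hL J hc hV (Finset.mem_powerset.1 (Finset.mem_filter.1 hQ).1)
  linarith

/-- **`|Z⁻_Λ(V)| ≤ Z_Λ`** for every spin cut-off (the two bounds combined). -/
theorem abs_torusZtw_le_torusZ (hL : Even L) (J : ℕ) {c : ℕ → ℝ} (hc : ∀ n, 1 ≤ n → 0 ≤ c n)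
    {V : Finset (Plaquette d L)} (hV : ∀ p ∈ V, IsCrossPlaq p) :
    |torusZtw d L J c V| ≤ torusZ d L J c :=
  abs_le.2 ⟨by linarith [neg_torusZ_le_torusZtw hL J hc hV], torusZtw_le_torusZ hL J hc hV⟩

/-- **`TwistLe d L J 𝒱` — Prop. IV.1 for EVERY spin cut-off `J`, on the even torus `(ℤ/Lℤ)^d` (`d ≥ 2`),
for the vortex sheet in every plane**: for every admissible coefficient sequence (`0 ≤ c_j ≤ 1`),
`Z⁻_Λ(𝒱_{ij}) ≤ Z_Λ` (the `(0,1)`-plane sheet consists of crossing plaquettes, `vortexSheet_isCrossPlaq`; the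
other planes by `twistLe_vortexSheet_iff_plane_zero_one`). -/
theorem twistLe_vortexSheet_plane (hL : Even L) (h01 : (0 : Fin d) < 1) (J : ℕ) {i j : Fin d}
    (hij : i < j) : TwistLe d L J (vortexSheet L i j hij) :=
  (twistLe_vortexSheet_iff_plane_zero_one h01 hij J).2 fun _c hc =>
    torusZtw_le_torusZ hL J (fun n hn => (hc n hn).1) (vortexSheet_isCrossPlaq 1 h01)

/-- **`|Z⁻_Λ(𝒱_{ij})| ≤ Z_Λ` for every plane and every spin cut-off** (even torus, `c_j ≥ 0`). -/
theorem abs_torusZtw_vortexSheet_le_torusZ (hL : Even L) (h01 : (0 : Fin d) < 1) (J : ℕ) {c : ℕ → ℝ}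
    (hc : ∀ n, 1 ≤ n → 0 ≤ c n) {i j : Fin d} (hij : i < j) :
    |torusZtw d L J c (vortexSheet L i j hij)| ≤ torusZ d L J c := by
  rw [torusZtw_vortexSheet_eq_plane_zero_one h01 hij]
  exact abs_torusZtw_le_torusZ hL J hc (vortexSheet_isCrossPlaq 1 h01)

/-- **`|Z⁻_Λ/Z_Λ| ≤ 1` for the vortex sheet in every plane, every spin cut-off** (even torus, `c_j ≥ 0`,
`Z_Λ ≠ 0`; arXiv:0707.2179 Prop. IV.1 eq. (4.6) with §6 eq. (6.1)). -/
theorem abs_vortexRatio_le_one_plane (hL : Even L) (h01 : (0 : Fin d) < 1) (J : ℕ) {c : ℕ → ℝ}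
    (hc : ∀ n, 1 ≤ n → 0 ≤ c n) {i j : Fin d} (hij : i < j) (hZ : torusZ d L J c ≠ 0) :
    |vortexRatio d L J c (vortexSheet L i j hij)| ≤ 1 := by
  have hZpos : 0 < torusZ d L J c := by
    rcases ((abs_nonneg (torusZtw d L J c (vortexSheet L i j hij))).trans
        (abs_torusZtw_vortexSheet_le_torusZ hL h01 J hc hij)).lt_or_eq with h | h
    · exact h
    · exact absurd h.symm hZ
  unfold vortexRatio
  rw [abs_div, abs_of_pos hZpos, div_le_one hZpos]
  exact abs_torusZtw_vortexSheet_le_torusZ hL h01 J hc hij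

end RP

end Summit.Ventures.YMGap.Census

end
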